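/-
Copyright (c) 2026 the pub-hodgecm-mathlib formalisation cell (harness21).  Prover seat hodgecm-mathlib-K2Liu-p10 (g3), Track B «K2-LIT»,
#184♮ = hLiu418 = `stmt-HodgeConjecture-24832`; LEAD F0P6-plan (g13) RULING «M-157j» (1): G5-a sub-organ (α), file (T2) — the Haar measure of
`N_Δ(𝔸)` is invariant under conjugation by rational elements normalising `N_Δ` (the `hconj` input of α3-2 `K2LiuConstantTermMiddleCellGL2`).
THEOREMS ONLY (no `def`, no `instance`, no named-fact hypothesis, no `sorry`).
-/
import Mathlib.MeasureTheory.Measure.Haar.Unique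
import Summits.HodgeConjecture.HodgeConjecture.Theorems.K2LiuConstantTermMiddleCellPrelims  -- α3-1: `exists_conj_mulEquiv`
import Summits.HodgeConjecture.HodgeConjecture.Theorems.K2LiuCoveringWeightTransport        -- α1: `isCoveringWeight_comp`
import Summits.HodgeConjecture.HodgeConjecture.Theorems.K2LiuUnipotentCocompact             -- ★ (C0) `exists_isCompact_cover_unipDelta`
import Summits.HodgeConjecture.HodgeConjecture.Theorems.K2LiuSiegelUnipotentHaarPinned       -- ★ `N_Δ(𝔸)` locally compact, second countable
import HarnessLib

/-!
# Crux `HLiu418`, ROAD Φ, (α) file (T2): `u ↦ p u p⁻¹` PRESERVES THE HAAR MEASURE OF `N_Δ(𝔸)` FOR `p ∈ H(L⁺)` NORMALISING `N_Δ` —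
# in particular for the rational Levi elements `p = Λ(ĝ)`, `g ∈ GL_n(L)` (the `hconj` input of α3-2)

Cell `hodgecm-mathlib`, crux item hLiu418 = `stmt-HodgeConjecture-24832` (helper lane, count-neutral).  `N = N_Δ(𝔸)` is a locally compact second
countable (★ `K2LiuSiegelUnipotentHaarPinned`) commutative group; the conjugation `φ_p : u ↦ p u p⁻¹` by an element `p ∈ H(𝔸)` normalising `N` is a
continuous automorphism, so `φ_p⁎ νN = c · νN` (Haar uniqueness, Mathlib `isMulLeftInvariant_eq_smul`); in general `c = |det Ad(p)|_𝔸` is NOT `1`, but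
for RATIONAL `p ∈ H(L⁺)` it is: `φ_p` preserves the lattice `N_Δ(L⁺)`, so it carries `N_Δ(L⁺)`-covering weights to `N_Δ(L⁺)`-covering weights (α1
`isCoveringWeight_comp`), all of which have the SAME total mass `covol(N_Δ(L⁺)∖N_Δ(𝔸))` (★ independence of the weight
`Literature.MeasureTheory.Group.lintegral_mul_eq_of_coveringSum_eq`), which is finite (★ (C0) `exists_isCompact_cover_unipDelta` + ★
`exists_isCoveringWeight_unipDeltaRat_lintegral_ne_top`) and positive; hence `c · covol = covol` and `c = 1` — the product formula in disguise.
* `lintegral_ne_zero_of_isCoveringWeight` — a covering weight of a countable subgroup has positive mass against a non-zero left-invariant measure;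
* `lintegral_comp_eq_of_isCoveringWeight` — `∫⁻ β ∘ φ dνN = ∫⁻ β dνN` for a measurable automorphism `φ` of `N` preserving `N_Δ(L⁺)` and an
  `N_Δ(L⁺)`-covering weight `β`;
* **`measurePreserving_conj`** — for `p ∈ H(L⁺)` with `p N p⁻¹ = N`: `MeasurePreserving (u ↦ p u p⁻¹) νN νN` for every Haar measure `νN` on `N`;
* **`measurePreserving_conj_levi`** — the case `p = Λ(ĝ)`, `g ∈ GL_n(L)` (α2c `conj_levi_mem_unipDelta`, `levi_map_mem_ratH`), literally the `hconj`
  hypothesis of α3-2 `hasSum_middle_cell`.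
Sources: [MoeglinWaldspurger1995, I.2.1, II.1.6–7]; Bourbaki, *Intégration* VII §2 no. 3–4; [CasselsFrohlichANT1967, Ch. II §14 (product formula ∕
compactness of `𝔸∕K`)]; [CogdellAnalyticTheory2004, §2.3].
HONEST LABEL.  Helper lemmas, count-neutral; `HC_CM` is proved only modulo the 7 printed citations (2 remaining named inputs:
hLiu418 = `stmt-HodgeConjecture-24832`, h413 = `stmt-HodgeConjecture-24833`) until rung 0 closes.
-/

set_option autoImplicit false
set_option linter.dupNamespace false -- the mandated namespace repeats `HodgeConjecture.HodgeConjecture`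

noncomputable section

open scoped Matrix ENNReal NNReal
open NumberField IsDedekindDomain MeasureTheory MeasureTheory.Measure Filter Set Function
open Literature.NumberTheory.Automorphic Literature.NumberTheory.Automorphic.UnitaryGroup Literature.NumberTheory.GaloisRepresentations
open Literature.NumberTheory.GelbartRogawski1991 Literature.NumberTheory.GelbartRogawski1991.GRConstruction
open Literature.NumberTheory.GelbartRogawski1991.AdaptedBlocks
open Literature.NumberTheory.K2Lit.SiegelDoubled Literature.MeasureTheory.Group
open UnitaryDualPair

namespace Summit.HodgeConjecture.HodgeConjecture.Cruxes.HLiu418.K2LiuUnipDeltaConjMeasurePreserving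

open K2LiuUnipotentCoveringWeight K2LiuUnipotentCocompact K2LiuSiegelUnipotentHaarPinned K2LiuCoveringWeightTransport
  K2LiuSiegelRationalLeviDecomposition K2LiuConstantTermMiddleCellPrelims

variable {L : Type} [Field L] [NumberField L] [IsCMField L]
variable {N M n : ℕ} {e : Fin N × Fin M ≃ Fin n}
  {dV : Fin N → L} {hdV : ∀ i, IsCMField.complexConj L (dV i) = dV i}
  {dW : Fin M → L} {hdW : ∀ i, IsCMField.complexConj L (dW i) = dW i}
variable [MeasurableSpace (unipDelta L e dV hdV dW hdW)] [BorelSpace (unipDelta L e dV hdV dW hdW)]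

/-! ## 1. Covering weights: positive mass, and invariance of the mass under lattice-preserving automorphisms -/

/-- **a covering weight has positive mass**: for a countable `Γ ≤ N` and a `Γ`-covering weight `β` (`Σ_γ β(γ u) = 1`), `∫⁻ β dνN ≠ 0` for every
non-zero left-invariant `νN` (else `β = 0` a.e., and integrating the covering sum gives `νN(N) = Σ_γ ∫⁻ β(γ ·) = 0`). [folklore] -/
theorem lintegral_ne_zero_of_isCoveringWeight (νN : Measure (unipDelta L e dV hdV dW hdW)) [νN.IsMulLeftInvariant] (hν : νN ≠ 0)
    (Γ : Subgroup (unipDelta L e dV hdV dW hdW)) [Countable Γ] {β : unipDelta L e dV hdV dW hdW → ℝ≥0∞} (hβ : IsCoveringWeight Γ β) :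
    ∫⁻ u, β u ∂νN ≠ 0 := by
  intro h0
  have hae : β =ᵐ[νN] 0 := (lintegral_eq_zero_iff hβ.1).1 h0
  -- `∫⁻ Σ_γ β(γ u) = Σ_γ ∫⁻ β(γ u) = Σ_γ ∫⁻ β = 0`
  have hsum : ∫⁻ u, coveringSum Γ β u ∂νN = 0 := by
    rw [show (fun u => coveringSum Γ β u) = fun u => ∑' γ : Γ, β ((γ : unipDelta L e dV hdV dW hdW) * u) from rfl,
      lintegral_tsum (f := fun (γ : Γ) (u : unipDelta L e dV hdV dW hdW) => β ((γ : unipDelta L e dV hdV dW hdW) * u))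
        fun γ : Γ => (hβ.1.comp (measurable_const_mul (γ : unipDelta L e dV hdV dW hdW))).aemeasurable]
    refine ENNReal.tsum_eq_zero.2 fun γ => ?_
    rw [lintegral_mul_left_eq_self (μ := νN) β (γ : unipDelta L e dV hdV dW hdW), h0]
  -- but `Σ_γ β(γ u) = 1`, so the integral is `νN(N) ≠ 0`
  simp only [hβ.2, lintegral_one] at hsum
  exact hν (Measure.measure_univ_eq_zero.1 hsum)

/-- **the mass of a covering weight is invariant under a lattice-preserving measurable automorphism**: if `φ : N ≃* N` is measurable and maps
`N_Δ(L⁺)` onto itself, then `∫⁻ β ∘ φ dνN = ∫⁻ β dνN` for every `N_Δ(L⁺)`-covering weight `β` — `β ∘ φ` is again an `N_Δ(L⁺)`-covering weight (α1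
`isCoveringWeight_comp`) and all covering weights have the same mass (★ `lintegral_mul_eq_of_coveringSum_eq` with `F = 1`).
[cite: MoeglinWaldspurger1995, II.1.6] [cite: CogdellAnalyticTheory2004, §2.3] -/
theorem lintegral_comp_eq_of_isCoveringWeight (νN : Measure (unipDelta L e dV hdV dW hdW)) [νN.IsMulLeftInvariant]
    (φ : unipDelta L e dV hdV dW hdW ≃* unipDelta L e dV hdV dW hdW) (hφ : Measurable φ)
    (hφΓ : (unipDeltaRat L e dV hdV dW hdW).comap φ.toMonoidHom = unipDeltaRat L e dV hdV dW hdW)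
    {β : unipDelta L e dV hdV dW hdW → ℝ≥0∞} (hβ : IsCoveringWeight (unipDeltaRat L e dV hdV dW hdW) β) :
    ∫⁻ u, β (φ u) ∂νN = ∫⁻ u, β u ∂νN := by
  haveI : Countable (unipDeltaRat L e dV hdV dW hdW) := countable_unipDeltaRat L e dV hdV dW hdW
  haveI : MeasurableConstSMul (unipDelta L e dV hdV dW hdW) (unipDelta L e dV hdV dW hdW) := ⟨fun g => measurable_const_mul g⟩
  haveI : SMulInvariantMeasure (unipDelta L e dV hdV dW hdW) (unipDelta L e dV hdV dW hdW) νN :=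
    ⟨fun g t _ht => by rw [show (fun x : unipDelta L e dV hdV dW hdW => g • x) ⁻¹' t = (fun x => g * x) ⁻¹' t from rfl, measure_preimage_mul]⟩
  have hβφ : IsCoveringWeight (unipDeltaRat L e dV hdV dW hdW) (fun u => β (φ u)) := by
    have h := isCoveringWeight_comp φ hφ (unipDeltaRat L e dV hdV dW hdW) hβ
    rwa [hφΓ] at h
  have key := lintegral_mul_eq_of_coveringSum_eq (Γ := unipDeltaRat L e dV hdV dW hdW) νN (F := fun _ => (1 : ℝ≥0∞)) measurable_const (fun _ _ => rfl)
    hβφ.1 hβ.1 one_ne_zero ENNReal.one_ne_top hβφ.2 hβ.2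
  simpa only [one_mul] using key

/-! ## 2. Conjugation by a rational normalising element preserves the Haar measure of `N_Δ(𝔸)` -/

/-- **`u ↦ p u p⁻¹` PRESERVES EVERY HAAR MEASURE OF `N_Δ(𝔸)` when `p ∈ H(L⁺)` normalises `N_Δ`.**  Proof: Haar uniqueness gives `φ_p⁎ νN = c • νN`
(`N_Δ(𝔸)` locally compact and second countable, ★ `K2LiuSiegelUnipotentHaarPinned`; `φ_p` a bi-continuous automorphism); a compactly supported
`N_Δ(L⁺)`-covering weight `β` of finite mass exists (★ (C0) `exists_isCompact_cover_unipDelta`, ★ `exists_isCoveringWeight_unipDeltaRat_lintegral_ne_top`), its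
mass is positive (§1) and equals that of `β ∘ φ_p` (§1; `φ_p` preserves `N_Δ(L⁺)` as `p` is rational), i.e. `c · ∫⁻β = ∫⁻β`, so `c = 1`.
[cite: MoeglinWaldspurger1995, I.2.1, II.1.6] [cite: CasselsFrohlichANT1967, Ch. II §14] -/
theorem measurePreserving_conj (hdV0 : ∀ i, dV i ≠ 0) (hdW0 : ∀ i, dW i ≠ 0) (νN : Measure (unipDelta L e dV hdV dW hdW)) [νN.IsHaarMeasure]
    {p : HA L e dV hdV dW hdW} (hpr : p ∈ ratH L e dV hdV dW hdW) (hp : ∀ u : HA L e dV hdV dW hdW, u ∈ unipDelta L e dV hdV dW hdW → p * u * p⁻¹ ∈ unipDelta L e dV hdV dW hdW)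
    (hp' : ∀ u : HA L e dV hdV dW hdW, u ∈ unipDelta L e dV hdV dW hdW → p⁻¹ * u * p ∈ unipDelta L e dV hdV dW hdW) :
    MeasurePreserving (fun u : unipDelta L e dV hdV dW hdW => (⟨p * (u : HA L e dV hdV dW hdW) * p⁻¹, hp _ u.2⟩ : unipDelta L e dV hdV dW hdW)) νN νN := by
  haveI : LocallyCompactSpace (unipDelta L e dV hdV dW hdW) := locallyCompactSpace_unipDelta L e dV hdV dW hdW
  haveI : SecondCountableTopology (unipDelta L e dV hdV dW hdW) := secondCountableTopology_unipDelta L e dV hdV dW hdW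
  haveI : Countable (unipDeltaRat L e dV hdV dW hdW) := countable_unipDeltaRat L e dV hdV dW hdW
  -- the automorphism `φ = φ_p`, abstract with its values
  obtain ⟨φ, hφ, hφs⟩ := exists_conj_mulEquiv p hp hp'
  have hφfun : (φ : unipDelta L e dV hdV dW hdW → unipDelta L e dV hdV dW hdW) = fun u : unipDelta L e dV hdV dW hdW => (⟨p * (u : HA L e dV hdV dW hdW) * p⁻¹, hp _ u.2⟩ : unipDelta L e dV hdV dW hdW) :=
    funext fun u => Subtype.ext (hφ u)
  have hφsfun : (φ.symm : unipDelta L e dV hdV dW hdW → unipDelta L e dV hdV dW hdW) = fun u : unipDelta L e dV hdV dW hdW => (⟨p⁻¹ * (u : HA L e dV hdV dW hdW) * p, hp' _ u.2⟩ : unipDelta L e dV hdV dW hdW) :=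
    funext fun u => Subtype.ext (hφs u)
  have hφc : Continuous (φ : unipDelta L e dV hdV dW hdW → unipDelta L e dV hdV dW hdW) := by
    rw [hφfun]; exact Continuous.subtype_mk ((continuous_const.mul continuous_subtype_val).mul continuous_const) _
  have hφsc : Continuous (φ.symm : unipDelta L e dV hdV dW hdW → unipDelta L e dV hdV dW hdW) := by
    rw [hφsfun]; exact Continuous.subtype_mk ((continuous_const.mul continuous_subtype_val).mul continuous_const) _
  have hφm : Measurable (φ : unipDelta L e dV hdV dW hdW → unipDelta L e dV hdV dW hdW) := hφc.measurable
  -- `φ` preserves the lattice `N_Δ(L⁺)`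
  have hφΓ : (unipDeltaRat L e dV hdV dW hdW).comap φ.toMonoidHom = unipDeltaRat L e dV hdV dW hdW := by
    ext u
    rw [Subgroup.mem_comap, MulEquiv.coe_toMonoidHom, mem_unipDeltaRat_iff, mem_unipDeltaRat_iff, hφ u]
    refine ⟨fun h => ?_, fun h => mul_mem (mul_mem hpr h) (inv_mem hpr)⟩
    have h' := mul_mem (mul_mem (inv_mem hpr) h) hpr
    rwa [← mul_assoc, ← mul_assoc, inv_mul_cancel, one_mul, mul_assoc, inv_mul_cancel, mul_one] at h'
  -- Haar uniqueness: `φ⁎ νN = c • νN`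
  haveI : IsHaarMeasure (Measure.map φ νN) := φ.isHaarMeasure_map νN hφc hφsc
  have hc := isMulLeftInvariant_eq_smul (Measure.map φ νN) νN
  -- a covering weight of finite positive mass
  obtain ⟨K, hK, hcover⟩ := exists_isCompact_cover_unipDelta L e dV hdV dW hdW hdV0 hdW0
  obtain ⟨β, hβ, -, -, hfin⟩ := exists_isCoveringWeight_unipDeltaRat_lintegral_ne_top L e dV hdV dW hdW νN hK hcover
  have hν : νN ≠ 0 := fun h => (isOpen_univ.measure_ne_zero νN Set.univ_nonempty) (by rw [h]; rfl)
  have hpos : ∫⁻ u, β u ∂νN ≠ 0 := lintegral_ne_zero_of_isCoveringWeight νN hν (unipDeltaRat L e dV hdV dW hdW) hβ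
  -- the two computations of `∫⁻ β ∘ φ`
  set c := haarScalarFactor (Measure.map φ νN) νN with hcdef
  have hcomp : ∫⁻ u, β (φ u) ∂νN = ∫⁻ u, β u ∂νN := lintegral_comp_eq_of_isCoveringWeight νN φ hφm hφΓ hβ
  have hmap : ∫⁻ u, β (φ u) ∂νN = (c : ℝ≥0∞) * ∫⁻ u, β u ∂νN := by
    rw [← lintegral_map hβ.1 hφm, hc, lintegral_smul_measure, ENNReal.smul_def, smul_eq_mul]
  have hc1 : c = 1 := by
    have h : (c : ℝ≥0∞) * ∫⁻ u, β u ∂νN = 1 * ∫⁻ u, β u ∂νN := by rw [one_mul, ← hmap, hcomp]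
    exact ENNReal.coe_eq_one.1 ((ENNReal.mul_left_inj hpos hfin).1 h)
  rw [hc1, one_smul] at hc
  rw [← hφfun]
  exact ⟨hφm, hc⟩

section Levi

variable (Λ : GL (Fin n) (AdeleRing (𝓞 L) L) →* HA L e dV hdV dW hdW)
  (hΛ : ∀ g : GL (Fin n) (AdeleRing (𝓞 L) L), blk L e dV hdV dW hdW (Λ g) =
    cayR (AdeleRing (𝓞 L) L) (Fin n) * Matrix.fromBlocks (g : Matrix (Fin n) (Fin n) (AdeleRing (𝓞 L) L)) 0 0
      (((gramR L e dV hdV dW hdW).map ((algebraMap L (AdeleRing (𝓞 L) L)).comp (algebraMap (Fp L) L)))⁻¹ *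
        (((g⁻¹ : GL (Fin n) (AdeleRing (𝓞 L) L)) : Matrix (Fin n) (Fin n) (AdeleRing (𝓞 L) L)).map
          (conjAdele (Fp L) L (IsCMField.complexConj L)))ᵀ *
        (gramR L e dV hdV dW hdW).map ((algebraMap L (AdeleRing (𝓞 L) L)).comp (algebraMap (Fp L) L))) *
      cayRinv (AdeleRing (𝓞 L) L) (Fin n))

include hΛ in
/-- **`u ↦ Λ(ĝ) u Λ(ĝ)⁻¹` PRESERVES THE HAAR MEASURE OF `N_Δ(𝔸)` for `g ∈ GL_n(L)`** — `measurePreserving_conj` for the rational Levi element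
`p = Λ(ĝ) ∈ P_Δ(L⁺)` (α2c `levi_map_mem_ratH`, `conj_levi_mem_unipDelta`, `inv_conj_levi_mem_unipDelta`).  This is LITERALLY the hypothesis `hconj` of
α3-2 `K2LiuConstantTermMiddleCellGL2.hasSum_middle_cell` ∕ `tsum_orbit_reflStd_levi_eq` (there `n = 2`). [cite: MoeglinWaldspurger1995, I.2.1, II.1.7] -/
theorem measurePreserving_conj_levi (hdV0 : ∀ i, dV i ≠ 0) (hdW0 : ∀ i, dW i ≠ 0) (νN : Measure (unipDelta L e dV hdV dW hdW)) [νN.IsHaarMeasure]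
    (g : GL (Fin n) L) :
    MeasurePreserving (fun u : unipDelta L e dV hdV dW hdW =>
      (⟨Λ (Matrix.GeneralLinearGroup.map (algebraMap L (AdeleRing (𝓞 L) L)) g) * (u : HA L e dV hdV dW hdW) *
          (Λ (Matrix.GeneralLinearGroup.map (algebraMap L (AdeleRing (𝓞 L) L)) g))⁻¹,
        conj_levi_mem_unipDelta L e dV hdV dW hdW Λ hΛ _ u.2⟩ : unipDelta L e dV hdV dW hdW)) νN νN :=
  measurePreserving_conj hdV0 hdW0 νN (levi_map_mem_ratH L e dV hdV dW hdW Λ hΛ hdV0 hdW0 g)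
    (fun _ hu => conj_levi_mem_unipDelta L e dV hdV dW hdW Λ hΛ _ hu) (fun _ hu => inv_conj_levi_mem_unipDelta L e dV hdV dW hdW Λ hΛ _ hu)

end Levi

end Summit.HodgeConjecture.HodgeConjecture.Cruxes.HLiu418.K2LiuUnipDeltaConjMeasurePreserving

end
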